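import Summits.BirchSwinnertonDyer.BirchSwinnertonDyer.Theorems.UniversalToricDescentSigmaCoinvariants
import Summits.BirchSwinnertonDyer.BirchSwinnertonDyer.Theorems.SchneiderFreeAdditiveX3AnticycControlAdditiveCoinvAnyTorsion
import HarnessLib

/-!
# Route UniversalToricDescent — the `Σ`-IMPRIMITIVE coinvariants vanish WITHOUT (iv):
# `(conj_γ − 1)` is onto `Sel_𝔭^Σ(K_∞, E[p^∞])` from Poitou–Tate ×2 and base finiteness alone

Lead prover bsd-wall-utd-p1 g13 (`--supports` ♭T′ stmt-BirchSwinnertonDyer-26975 `DefectTransportModThreePT`,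
item (M0) of the registered stub B′ `stub_lambdaTransportPT`: the `Σ`-machinery of the algebraic half without the
local hypothesis (iv) `E(ℚ₃)[3] = 0`, which fails on 206 of the 2 023 habitat classes). g7's
`UniversalToricDescentSigmaCoinvariants.surjective_conjSelmerAc_sub_one_of_subsingleton` (JSW17 Lemma 3.3.3 for the
`Σ`-imprimitive Selmer group) carries the hypothesis `E[p^∞]^{Γ_{K_𝔭}} = 0` only because its Poitou–Tate surgery
step is the R1 engine's `levelLiftingP_of_finite`; the X3 cell (door-c4, `…CoinvAnyTorsion`) replaced that step at
`Σ = ∅` by `levelLiftingP_of_finite_anyTorsion`, whose input is a killing exponent `p^m` of the finite group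
`E(K̄)[p^∞]^{D_𝔮}` at the OTHER prime `𝔮 ∣ p`. This file is the same substitution for arbitrary `Σ`:

* §1 `surjective_conjSelmerAc_sub_one_of_subsingleton_anyTorsion` — `K` totally complex, the cited Poitou–Tate
  fact for `K`, Milne I 2.8 at the completions, `𝔭 ≠ 𝔮` above `p`, a killing exponent at `𝔮`, `Sel_𝔮(K, E[p^∞])`
  finite, `H²(K, E[p^∞]) = 0`, `γ` a topological generator ⟹ `conj_γ − 1` is ONTO `Sel_𝔭^Σ(K_∞, E[p^∞])` for
  every set `Σ` of places prime to `p` (proof VERBATIM g7's, one line changed).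
* §2 `surjective_conjSelmerAc_sub_one_baseChange_anyTorsion` / `forall_finite_eq_bot_sigma_anyTorsion` — for `E/ℚ`,
  `K` imaginary quadratic with `p` split, a degree-one `𝔭 ∋ p`, ANY `ℤ_p`-extension with topological generator,
  ANY `Σ`, from Poitou–Tate ×2 and `Sel_v(K, E[p^∞])` finite at both `v ∣ p` — NO (iv): (L10)^Σ, (N1)^Σ and
  `X_ac^Σ[T] = 0` (`H² = 0` by `subsingleton_galoisCohomology_two_primary_anyTorsion`, the killing exponents by
  `exists_pow_nsmul_local_eq_zero` / `exists_pow_nsmul_fixedPoints_decomp_eq_zero`).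

Sequel files port `…SigmaLocalSurjective` / `…SigmaLocalIndex` / `…SigmaLocalProduct` (the `Σ`-Euler-factor product
`#(Sel^Σ/Sel^∅)[p] = ∏_{v∈Σ} (#H¹(H ∩ D_v, E[p^∞])[p])^{p^{c_v}}`) to the same input. HONEST STATUS: helper theorems,
CONDITIONAL on the cited Poitou–Tate facts like every (L10)-descendant; the residual comparison at the strict place
without (L) (M1) and the twin's no-finite-submodule / `Σ`-surjectivity at arbitrary `K`-rank (M2)/(M3) are NOT
touched. THEOREMS ONLY; no definition, no named fact, no `sorry`. BSD is not advanced by this file.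
References: [JetchevSkinnerWan2017] Lemma 3.3.3, Prop. 3.3.2 (arXiv:1512.06894 pp. 11–12); [Castella2018] Def. 2.2,
Thm. 2.3; [MilneADT2006] I 2.8, 4.10; [GreenbergLNM1716] Prop. 4.14–4.15 (pp. 124–126).
-/

set_option autoImplicit false
-- `…BirchSwinnertonDyer.BirchSwinnertonDyer.Theorems…` is the problem's mandated namespace (D-0017).
set_option linter.dupNamespace false

noncomputable section

open scoped Classical

namespace Summit.BirchSwinnertonDyer.BirchSwinnertonDyer.Theorems.UniversalToricDescentSigmaCoinvariants

open CategoryTheory Function Field NumberField IsDedekindDomain WeierstrassCurve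
open Literature.NumberTheory.GaloisRepresentations Literature.NumberTheory.EllipticCurves
  Literature.NumberTheory.EllipticCurves.GreenbergSelmer Literature.NumberTheory.GaloisCohomology
  Literature.NumberTheory.EllipticCurves.IwasawaAlgebra Literature.NumberTheory.EllipticCurves.Rank1Residual
  Summit.BirchSwinnertonDyer.Rank1Residual Summit.BirchSwinnertonDyer.Rank1Residual.X11b
  Summit.BirchSwinnertonDyer.Rank1Residual.X11b.Coinv Summit.BirchSwinnertonDyer.Rank1Residual.X11b.LocBridge
  Summit.BirchSwinnertonDyer.Rank1Residual.X11b.AcSelmer Summit.BirchSwinnertonDyer.Rank1Residual.X11b.H2Support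
  Summit.BirchSwinnertonDyer.Rank1Residual.X11b.Levels Summit.BirchSwinnertonDyer.Rank1Residual.Iwasawa
  Summit.BirchSwinnertonDyer.BirchSwinnertonDyer.Theorems.UniversalToricDescentNoFiniteSubmodule
  Summit.BirchSwinnertonDyer.BirchSwinnertonDyer.Theorems.UniversalToricDescentStrictPlace
  Summit.BirchSwinnertonDyer.BirchSwinnertonDyer.Theorems.SchneiderFreeAdditiveX3
open Summit.BirchSwinnertonDyer.Rank1Residual.X11b.ProcyclicDescent (kerK)

/-! ### §1 JSW17 Lemma 3.3.3 for `Sel_𝔭^Σ` with a killing exponent at `𝔮` instead of `E[p^∞]^{Γ_{K_𝔭}} = 0` -/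

section Sigma

variable {K : Type} [Field K] [NumberField K] (W : WeierstrassCurve K) [W.IsElliptic] (p : ℕ)
  [Fact p.Prime] (κ : ZpExtension K p)

-- adapted from `surjective_conjSelmerAc_sub_one_of_subsingleton` (this namespace, g7) with the Poitou–Tate surgery step
-- of `SchneiderFreeAdditiveX3.coinvariantsTrivialAt_of_subsingleton_anyTorsion` (door-c4 / X3 cell).
/-- **(L10) for `Sel_𝔭^Σ` WITHOUT (iv): `conj_γ − 1` is ONTO `Sel_𝔭^Σ(K_∞, E[p^∞])`** for any set `Σ` of places
prime to `p`. Hypotheses: `K` totally complex; the cited Poitou–Tate fact for `K` and Milne I 2.8 at the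
completions; `𝔭 ≠ 𝔮` above `p`; a killing exponent `p^m` of `E(K̄)[p^∞]^{D_𝔮}`; `Sel_𝔮(K, E[p^∞])` finite;
`H²(K, E[p^∞]) = 0`; `γ` a topological generator of `κ`. Proof = g7's (procyclic descent from `H² = 0`, local
lifts off `Σ` and at `𝔭`, Poitou–Tate surgery, correction), the surgery done by `levelLiftingP_of_finite_anyTorsion`.
[cite: JetchevSkinnerWan2017, Lemma 3.3.3 and Prop. 3.3.2 (arXiv:1512.06894 pp. 11–12)]
[cite: Castella2018, Def. 2.2 and Thm. 2.3 (arXiv:1704.06608 p. 5)] -/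
theorem surjective_conjSelmerAc_sub_one_of_subsingleton_anyTorsion [IsTotallyComplex K]
    (hPT : poitouTate_selmerStructure_duality K)
    (hEP : ∀ v : HeightOneSpectrum (𝓞 K), localEulerPoincareCharacteristic (v.adicCompletion K))
    {𝔭 𝔮 : HeightOneSpectrum (𝓞 K)} (h𝔭 : ((p : ℕ) : 𝓞 K) ∈ 𝔭.asIdeal)
    (h𝔮 : ((p : ℕ) : 𝓞 K) ∈ 𝔮.asIdeal) (hne : 𝔮 ≠ 𝔭)
    {m : ℕ} (htor𝔮 : ∀ Q : W.geomPrimaryTorsion p, (∀ d ∈ decomp 𝔮, d • Q = Q) → p ^ m • Q = 0)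
    (hfin : Finite (selmerAcBase W p 𝔮 ∅))
    (h2 : Subsingleton (galoisCohomology (primaryGaloisModule W p) 2))
    {γ : absoluteGaloisGroup K} (hγ : κ.IsTopGenerator γ) (S : Set (HeightOneSpectrum (𝓞 K))) :
    Function.Surjective
      ((conjSelmerAc W p κ 𝔭 S γ - 1 : AddMonoid.End (selmerAc W p κ 𝔭 S)) :
        selmerAc W p κ 𝔭 S → selmerAc W p κ 𝔭 S) := by
  intro x
  have hM : ∀ m : W.geomPrimaryTorsion p, IsOpen {σ : absoluteGaloisGroup K | σ • m = m} :=
    isOpen_stabilizer_geomPrimaryTorsion W p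
  -- (1) `y₀` with `conj_γ y₀ - y₀ = x`
  obtain ⟨y₀, hy₀⟩ :=
    exists_conjH1_sub_eq_of_subsingleton W p κ h2 hγ (x : W.subgroupH1 p κ.kerSubgroup)
  -- (2) all conjugates of `y₀` agree with `y₀` modulo `Sel^Σ`
  have hSel : ∀ g : absoluteGaloisGroup K,
      W.conjH1 p κ.kerSubgroup g y₀ - y₀ ∈ selmerAc W p κ 𝔭 S :=
    conjH1_sub_mem_selmerAc_of_isTopGenerator hγ (by rw [hy₀]; exact x.2)
  -- the cocycle of `y₀` and its zero set
  obtain ⟨φ, hφ⟩ := oneCocycleClass_surjective _ y₀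
  obtain ⟨N₁, hN₁⟩ := exists_openNormalSubgroup_forall_apply_eq_zero (K := K) φ
  -- the exceptional set `Σ'` (finite, away from `p`)
  set S' : Set (HeightOneSpectrum (𝓞 K)) := {v | ((p : ℕ) : 𝓞 K) ∉ v.asIdeal ∧
    (¬ W.HasGoodReductionAt v ∨
      ¬ (adicCompletionPrime K v).inertia (absoluteGaloisGroup K) ≤ (N₁ : Subgroup _))} with hS'
  have hS'fin : S'.Finite := finite_exceptional W p N₁
  have hSp : ∀ v ∈ S', ((p : ℕ) : 𝓞 K) ∉ v.asIdeal := fun v hv ↦ hv.1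
  -- (3) the local lifts, at the places OFF `Σ` (and at `𝔭`)
  have hz : ∀ v : HeightOneSpectrum (𝓞 K), ((((p : ℕ) : 𝓞 K) ∉ v.asIdeal ∧ v ∉ S) ∨ v = 𝔭) →
      ∃ z : subgroupH1 (decomp (K := K) v) (W.geomPrimaryTorsion p),
        ResKernel.resSubgroup (kerD κ v) (W.geomPrimaryTorsion p) z =
          resKerD κ (W.geomPrimaryTorsion p) v y₀ := fun v hv ↦
    exists_resSubgroup_kerD_eq v hv hSel
  choose z hz using hz
  -- at the good unramified `v ∉ Σ' ∪ Σ`, `v ∤ p`: `Ψ_v = 0` and `y₀` is locally trivial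
  have hzero : ∀ (v : HeightOneSpectrum (𝓞 K)) (hpv : ((p : ℕ) : 𝓞 K) ∉ v.asIdeal) (hvS0 : v ∉ S),
      v ∉ S' → resKerD κ (W.geomPrimaryTorsion p) v y₀ = 0 := by
    intro v hpv hvS0 hvS
    have hgood : W.HasGoodReductionAt v := by
      by_contra h; exact hvS ⟨hpv, Or.inl h⟩
    have hI : (adicCompletionPrime K v).inertia (absoluteGaloisGroup K) ≤ (N₁ : Subgroup _) := by
      by_contra h; exact hvS ⟨hpv, Or.inr h⟩
    have h := hz v (Or.inl ⟨hpv, hvS0⟩)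
    rw [← hφ] at h ⊢
    exact (eq_zero_of_inertia_le hpv hgood φ hN₁ hI (z v (Or.inl ⟨hpv, hvS0⟩)) h).2
  -- the finite set `T` of places: `∞ ∪ {v ∣ p} ∪ Σ'`
  have hp0 : p ≠ 0 := (Fact.out : p.Prime).ne_zero
  set T : Finset (Place K) := (Finset.univ.image Sum.inl) ∪
    (((finite_setOf_natCast_mem (K := K) p hp0).toFinset ∪ hS'fin.toFinset).image Sum.inr) with hT
  have hinf : ∀ w : InfinitePlace K, (Sum.inl w : Place K) ∈ T := fun w ↦
    Finset.mem_union_left _ (Finset.mem_image_of_mem _ (Finset.mem_univ w))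
  have hpT : ∀ v : HeightOneSpectrum (𝓞 K), ((p : ℕ) : 𝓞 K) ∈ v.asIdeal →
      (Sum.inr v : Place K) ∈ T := fun v hv ↦
    Finset.mem_union_right _ (Finset.mem_image_of_mem _
      (Finset.mem_union_left _ ((Set.Finite.mem_toFinset _).mpr hv)))
  have hSig : ∀ v ∈ S', (Sum.inr v : Place K) ∈ T := fun v hv ↦
    Finset.mem_union_right _ (Finset.mem_image_of_mem _
      (Finset.mem_union_right _ ((Set.Finite.mem_toFinset _).mpr hv)))
  have hbad : ∀ v : HeightOneSpectrum (𝓞 K), ¬ W.HasGoodReductionAt v →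
      (Sum.inr v : Place K) ∈ T := by
    intro v hv
    by_cases hpv : ((p : ℕ) : 𝓞 K) ∈ v.asIdeal
    · exact hpT v hpv
    · exact hSig v ⟨hpv, Or.inl hv⟩
  have hRfin : {v : HeightOneSpectrum (𝓞 K) | (Sum.inr v : Place K) ∈ T ∧
      ((p : ℕ) : 𝓞 K) ∉ v.asIdeal}.Finite :=
    (T.finite_toSet.preimage Sum.inr_injective.injOn).subset fun v hv ↦ hv.1
  have hfinR := finite_relaxed W p (𝔮 := 𝔮) hEP hfin hRfin (fun v hv ↦ hv.2)
  -- the family of local classes on `Σ'⁺ = Σ' ∪ {𝔭}` (zero at the places of `Σ`) and a killing exponent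
  let τ : ∀ v : (insert 𝔭 S' : Set (HeightOneSpectrum (𝓞 K))),
      galoisCohomology
        ((primaryGaloisModule W p).toLocal (Sum.inr (v : HeightOneSpectrum (𝓞 K)))) 1 :=
    fun v ↦
      if h : ((((p : ℕ) : 𝓞 K) ∉ (v : HeightOneSpectrum (𝓞 K)).asIdeal ∧
          (v : HeightOneSpectrum (𝓞 K)) ∉ S) ∨ (v : HeightOneSpectrum (𝓞 K)) = 𝔭) then
        inflDecomp hM (v : HeightOneSpectrum (𝓞 K)) (z v h)
      else 0
  obtain ⟨K₀, hK₀⟩ := exists_pow_nsmul_family_eq_zero (hS'fin.insert 𝔭) τ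
  -- (4) Poitou–Tate surgery
  obtain ⟨N, xN, hxN, hloc⟩ := SchneiderFreeAdditiveX3.levelLiftingP_of_finite_anyTorsion W p 𝔭 S' T hPT
    (fun w ↦ IsTotallyComplex.isComplex w) h𝔭 h𝔮 hne hSp hinf hpT hSig hbad hfinR htor𝔮 K₀ τ hK₀
  set g : galoisCohomology (primaryGaloisModule W p) 1 :=
    galoisCohomology.map (Levels.primaryInclusion W p N) 1 xN with hg
  -- (5) the corrected class
  set y : W.subgroupH1 p κ.kerSubgroup :=
    y₀ - ResKernel.resSubgroup κ.kerSubgroup (W.geomPrimaryTorsion p) (toDiscreteH1 hM g) with hy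
  have hconj : ∀ σ : absoluteGaloisGroup K, W.conjH1 p κ.kerSubgroup σ y =
      y + (W.conjH1 p κ.kerSubgroup σ y₀ - y₀) := by
    intro σ
    rw [hy, map_sub, conjH1_resSubgroup]
    abel
  -- the local computation of `y`
  have hresy : ∀ (v : HeightOneSpectrum (𝓞 K)), resKerD κ (W.geomPrimaryTorsion p) v y =
      resKerD κ (W.geomPrimaryTorsion p) v y₀ -
        ResKernel.resSubgroup (kerD κ v) (W.geomPrimaryTorsion p)
          (ResKernel.resSubgroup (decomp v) (W.geomPrimaryTorsion p) (toDiscreteH1 hM g)) := by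
    intro v
    rw [hy, map_sub, resKerD_resSubgroup]
  have haway : ∀ (v : HeightOneSpectrum (𝓞 K))
      (hv : (((p : ℕ) : 𝓞 K) ∉ v.asIdeal ∧ v ∉ S) ∨ v = 𝔭),
      y ∈ awayKer κ.kerSubgroup (W.geomPrimaryTorsion p) v := by
    intro v hv
    rw [mem_awayKer_iff_resKerD_eq_zero, hresy]
    by_cases hvI : v ∈ insert 𝔭 S'
    · -- prescribed place: `loc_v g = infl Ψ_v`
      have hl := hloc ⟨v, hvI⟩
      have hτ : τ ⟨v, hvI⟩ = inflDecomp hM v (z v hv) := dif_pos hv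
      rw [hτ] at hl
      have e : ResKernel.resSubgroup (decomp v) (W.geomPrimaryTorsion p) (toDiscreteH1 hM g) =
          z v hv :=
        resSubgroup_decomp_eq_of_localization_eq hM v g _ hl
      rw [e, hz, sub_self]
    · -- other place away from `p`: `loc_v g = 0` and `y₀` locally trivial
      have hpvS0 : ((p : ℕ) : 𝓞 K) ∉ v.asIdeal ∧ v ∉ S := by
        rcases hv with h | rfl
        · exact h
        · exact (hvI (Set.mem_insert _ _)).elim
      have hvS : v ∉ S' := fun h ↦ hvI (Set.mem_insert_of_mem _ h)
      have h0 : galoisCohomology.localization (primaryGaloisModule W p) (Sum.inr v) 1 g = 0 :=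
        localization_map_primaryInclusion_eq_zero_of_mem_upperStructureP W p N 𝔭 S' hxN h𝔭 hpvS0.1
          hvS
      rw [resSubgroup_decomp_eq_zero_of_localization_eq_zero hM v g h0, map_zero, sub_zero]
      exact hzero v hpvS0.1 hpvS0.2 hvS
  have hySel : y ∈ selmerAc W p κ 𝔭 S := by
    change y ∈ selmerOver κ.kerSubgroup (W.geomPrimaryTorsion p) p 𝔭 S
    rw [mem_selmerOver_iff_awayKer]
    refine ⟨fun v hpv hvS0 σ ↦ ?_, fun w σ ↦ ?_, fun σ ↦ ?_⟩
    · rw [hconj]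
      exact add_mem (haway v (Or.inl ⟨hpv, hvS0⟩)) ((mem_awayKer_iff_resKerD_eq_zero κ v _).2
        (resKerD_eq_zero_of_mem_selmerAc (Or.inl ⟨hpv, hvS0⟩) (hSel σ)))
    · exact mem_infKer_of_decompInf_eq_bot w
        (decompInf_eq_bot_of_isComplex (IsTotallyComplex.isComplex w)) _
    · rw [hconj]
      exact add_mem (haway 𝔭 (Or.inr rfl)) ((mem_awayKer_iff_resKerD_eq_zero κ 𝔭 _).2
        (resKerD_eq_zero_of_mem_selmerAc (Or.inr rfl) (hSel σ)))
  refine ⟨⟨y, hySel⟩, Subtype.ext ?_⟩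
  change W.conjH1 p κ.kerSubgroup γ y - y = (x : W.subgroupH1 p κ.kerSubgroup)
  rw [hconj, hy₀]
  abel

end Sigma

/-! ### §2 `E/ℚ` over an imaginary quadratic `K` with `p` split: (L10)^Σ, (N1)^Σ, `X^Σ[T] = 0` with NO (iv) -/

section Route

variable (W : WeierstrassCurve ℚ) [W.IsElliptic] [W.IsGloballyMinimal] (p : ℕ) [Fact p.Prime]
  {K : Type} [Field K] [NumberField K]

/-- **(L10) for `Sel_𝔭^Σ(K_∞, E_K[p^∞])` WITHOUT (iv).** For `E/ℚ`, `K` imaginary quadratic with `p` split, a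
degree-one `𝔭 ∋ p` as the strict place, ANY `ℤ_p`-extension `κ` with topological generator `γ`, ANY `Σ`, and
`Sel_v(K, E[p^∞])` finite at both `v ∣ p`: `conj_γ − 1` is onto `Sel_𝔭^Σ(K_∞, E[p^∞])`, GIVEN Poitou–Tate ×2
(`H²(K, E[p^∞]) = 0` from `subsingleton_galoisCohomology_two_primary_anyTorsion`; the killing exponents from the
finiteness of `E(K_v)[p^∞]`). The `Σ = ∅` case is the X3 cell's `coinvariantsTrivialAt_of_finite_anyTorsion`; the
(iv)-version is g7's `surjective_conjSelmerAc_sub_one_of_noPTorsionPadic`.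
[cite: JetchevSkinnerWan2017, Lemma 3.3.3 (arXiv:1512.06894 pp. 11–12)] [cite: MilneADT2006, Ch. I, Thm. 4.10 and Thm. 2.8] -/
theorem surjective_conjSelmerAc_sub_one_baseChange_anyTorsion
    (hPT : poitouTate_selmerStructure_duality K) (hPT2 : poitouTate_sha_tateDual K)
    (hK : IsImaginaryQuadratic K) (hsplit : SplitsIn K p)
    (κ : ZpExtension K p) {γ : absoluteGaloisGroup K} (hγ : κ.IsTopGenerator γ)
    {𝔭 : HeightOneSpectrum (𝓞 K)} (h𝔭 : ((p : ℕ) : 𝓞 K) ∈ 𝔭.asIdeal)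
    (hfin : ∀ v : HeightOneSpectrum (𝓞 K), ((p : ℕ) : 𝓞 K) ∈ v.asIdeal →
      Finite (selmerAcBase (W.baseChange K) p v ∅))
    (S : Set (HeightOneSpectrum (𝓞 K))) :
    Function.Surjective
      ((conjSelmerAc (W.baseChange K) p κ 𝔭 S γ - 1 : AddMonoid.End (selmerAc (W.baseChange K) p κ 𝔭 S)) :
        selmerAc (W.baseChange K) p κ 𝔭 S → selmerAc (W.baseChange K) p κ 𝔭 S) := by
  haveI : IsTotallyComplex K := hK.2
  haveI hEK : (W.baseChange K).IsElliptic := by rw [WeierstrassCurve.baseChange]; infer_instance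
  obtain ⟨σ, 𝔮, -, hne, h𝔮, -⟩ :=
    LocalIndexTransport.exists_conj_prime_of_splitsIn K p hK.1 hsplit h𝔭
  have htor := exists_pow_nsmul_local_eq_zero W p hK.1 hsplit
  haveI := hfin 𝔭 h𝔭
  have h2 := subsingleton_galoisCohomology_two_primary_anyTorsion (W.baseChange K) p 𝔭 ∅ hPT2
    (fieldCdLE_two_of_isTotallyComplex fieldCdLE_two_of_numberField_holds K p) htor
  obtain ⟨he𝔮, hf𝔮⟩ := degreeOne_of_splitsIn hK.1 hsplit h𝔮
  obtain ⟨m, hm⟩ := exists_pow_nsmul_fixedPoints_decomp_eq_zero W p 𝔮 h𝔮 he𝔮 hf𝔮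
  exact surjective_conjSelmerAc_sub_one_of_subsingleton_anyTorsion (W.baseChange K) p κ hPT
    (fun v ↦ GaloisImage.EP.localEulerPoincareCharacteristic_adicCompletion K v) h𝔭 h𝔮 hne hm
    (hfin 𝔮 h𝔮) h2 hγ S

/-- **(N1) and `X[T] = 0` for `X_ac^Σ(E_K)` WITHOUT (iv)**, same hypotheses: no non-zero finite `Λ`-submodule and
trivial `Γ`-invariants (§2 + `XAc.forall_finite_eq_bot_of_surjective`). At `Σ = ∅` this is (N1) for `X_{∅,0}(E)` in
stub B′ of ♭T′ from the wild curve's base finiteness alone.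
[cite: GreenbergLNM1716, Prop. 4.14–4.15 (pp. 124–126)] [cite: JetchevSkinnerWan2017, Lemma 3.3.3 (arXiv:1512.06894 pp. 11–12)] -/
theorem forall_finite_eq_bot_sigma_anyTorsion
    (hPT : poitouTate_selmerStructure_duality K) (hPT2 : poitouTate_sha_tateDual K)
    (hK : IsImaginaryQuadratic K) (hsplit : SplitsIn K p)
    (κ : ZpExtension K p) (γ : absoluteGaloisGroup K) [hγ : Fact (κ.IsTopGenerator γ)]
    {𝔭 : HeightOneSpectrum (𝓞 K)} (h𝔭 : ((p : ℕ) : 𝓞 K) ∈ 𝔭.asIdeal)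
    (hfin : ∀ v : HeightOneSpectrum (𝓞 K), ((p : ℕ) : 𝓞 K) ∈ v.asIdeal →
      Finite (selmerAcBase (W.baseChange K) p v ∅))
    (S : Set (HeightOneSpectrum (𝓞 K))) :
    (∀ N : Submodule (IwasawaAlgebra p) (XAc (W.baseChange K) p κ 𝔭 S γ), Finite N → N = ⊥) ∧
      invariants p (XAc (W.baseChange K) p κ 𝔭 S γ) = ⊥ :=
  have hs := surjective_conjSelmerAc_sub_one_baseChange_anyTorsion W p hPT hPT2 hK hsplit κ hγ.out h𝔭 hfin S
  ⟨XAc.forall_finite_eq_bot_of_surjective (W.baseChange K) p κ 𝔭 S γ hs,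
    XAc.invariants_eq_bot_of_surjective (W.baseChange K) p κ 𝔭 S γ hs⟩

end Route

end Summit.BirchSwinnertonDyer.BirchSwinnertonDyer.Theorems.UniversalToricDescentSigmaCoinvariants

end
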